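import Summits.Parity.GeneralizedHardyLittlewood.Theorems.BeyondDiagonalBeatsQuarter.OffDiagCoreWinSeparatedBlock
import Summits.Parity.GeneralizedHardyLittlewood.Theorems.BeyondDiagonalBeatsQuarter.OffDiagCoreWinUnitBox
import HarnessLib

/-!
# Route `PrimeLevelFamEdge`, crux K_B (stmt-Parity-20343), line `diagonal_kernel_split` rev 4, plan Ω,
# node **L7d part 2, leaf F1a — one member over one block: the complete separated unit-box form**
# (L7D-PLAN rev 6 §6 F1; S₃′ `levelLargePart_window_block_eq_separated` ∘ S₄ `levelLargePart_boxTransform_eq_unitBox`)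

For a member `x = (cell, h₁, s)` (`l, m ≥ 1`, `d₁ ∣ l`, `d₂ ∣ m`) and a block `Q ⊆ [β₁, β₂] ∩ [1, P−1]` of prime levels
`q ≥ 40`, `q > |h₁|`:

  `levelLargePart R Q (q ↦ 𝟙[window_x q]·coreLevelWeight D (coreHeight ε₀) Δ′ x q) n a
     = E_x · Σ_{k<P} convexCoeff((coreRange_x ∧ window_x) ∧ block) P k · Σ_{w∈3×3} t_{w₁}(l)t_{w₂}(m) ·
         (K₁K₂) • ∫dτ₁∫dτ₂ Kern_x(τ) · levelLargePart R Q (q ↦ e(kq/P)·2q̂(2π/q)·u(q)^{|w|} · Ψ_τ(x; 1/q)) n a`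

(**`levelLargePart_window_block_eq_unitBox`**): member-dependence only in level-FREE scalars (`E_x`, `convexCoeff`, `t(l)t(m)`,
`K₁K₂`) and in the `τ`-kernel `Kern_x`, `Ψ_τ(x; ·)`; the level weight `e(kq/P)·2q̂(2π/q)·u(q)^{|w|}` is universal. The Taylor
separation of `Ψ_τ` (S₅) and the family large sieve (F2b) then act on the integrand pointwise in `τ`.

Exact identity; standard axioms. Helper toward `stub_offDiagBelowSlack_io`; closes nothing.
«The programme SEARCHES and TYPES; no claim about Landau–Siegel zeros, Theorems 1–2 of arXiv:2211.02515 or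
a repaired Margin232 until a kernel theorem says so.»
-/

noncomputable section

open Finset Real Complex MeasureTheory Polynomial
open scoped Nat

namespace Summit.Parity.GeneralizedHardyLittlewood.Theorems.BeyondDiagonalBeatsQuarter.OffDiag

open Literature.Analysis.FunctionSpaces (besselJ)
open Literature.Analysis.Calculus.WhitneyConvex (dyadicBump)
open Literature.NumberTheory.LFunctions Literature.NumberTheory.LFunctions.KMV2000
open Literature.NumberTheory.Sieve.FriedlanderIwaniecPrimes (fourier2 ker)
open Literature.NumberTheory.Sieve.LargeSieve (e sepCoeff sepWeight)
open PeterssonSplit (nearBoxes)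

open Classical in
/-- **One member over one block, fully separated on the unit box.** See the module docstring.
[cite: KowalskiMichelVanderKam2000, §6 p. 19, (21)–(23) p. 12 — derivation; Vaughan1980, Lemma 2 — derivation] -/
theorem levelLargePart_window_block_eq_unitBox {P : ℕ} (R : ℕ) (Q : Finset ℕ) (hQ : Q ⊆ Finset.Icc 1 (P - 1))
    {β₁ β₂ : ℕ} (hQb : ∀ q ∈ Q, β₁ ≤ q ∧ q ≤ β₂)
    {Δ' : ℝ} (hΔ : 0 < Δ') {ε₀ : ℝ} (hε₀ : 0 ≤ ε₀) (D : ℕ → ℕ → ℕ → ℕ → ℕ → ℕ × ℕ → ℤ → ℤ → ℂ) (T : ℕ)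
    {r l m d₁ d₂ : ℕ} (hl : 1 ≤ l) (hm : 1 ≤ m) (hd₁ : d₁ ∣ l) (hd₂ : d₂ ∣ m) (i : ℕ × ℕ) {h₁ : ℤ} (s : ℤ)
    (hQp : ∀ q ∈ Q, q.Prime ∧ 40 ≤ q ∧ |h₁| < q) {n : ℕ} (a : ZMod n) :
    levelLargePart R Q (fun q ↦ if (T : ℝ) <
          |(s : ℝ) + ((((l / d₁ : ℕ) : ℤ) * (m / d₂ : ℕ) : ℤ) : ℝ) / ((q * (r + 1) : ℕ) : ℝ)| then 0 else
        coreLevelWeight D (coreHeight ε₀) Δ' r l m d₁ d₂ i h₁ s q) n a =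
      ((if IsUnit ((h₁ : ℤ) : ZMod (r + 1)) ∧ h₁ ≠ 0 then (1 : ℂ) else 0) *
          (if ((switchGcd (r + 1) s h₁ : ℤ) ∣ ((l / d₁ : ℕ) : ℤ) * (m / d₂ : ℕ) ∧
              IsUnit (switchClass (r + 1) (((l / d₁ : ℕ) : ℤ) * (m / d₂ : ℕ)) s h₁)) then (1 : ℂ) else 0) *
          D r l m d₁ d₂ i h₁ s) *
        ∑ k ∈ Finset.range P,
          convexCoeff (fun q ↦ (coreRange Δ' ε₀ r l m d₁ d₂ i h₁ q ∧
              ¬ ((T : ℝ) < |(s : ℝ) + ((((l / d₁ : ℕ) : ℤ) * (m / d₂ : ℕ) : ℤ) : ℝ) / ((q * (r + 1) : ℕ) : ℝ)|)) ∧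
              (β₁ ≤ q ∧ q ≤ β₂)) P k *
            ∑ w ∈ Finset.range 3 ×ˢ Finset.range 3,
              ((trinomCoeff l w.1 * trinomCoeff m w.2 : ℝ) : ℂ) *
                (((2 : ℝ) ^ i.1 * 2 ^ i.2 : ℝ) •
                  ∫ τ₁, ∫ τ₂, (((dyadicBump τ₁ * dyadicBump τ₂ *
                      (((d₁ : ℝ) * (2 ^ i.1 * τ₁) * ((d₂ : ℝ) * (2 ^ i.2 * τ₂))) ^ (-(1 / 2 : ℝ)) *
                        (((r + 1 : ℕ) : ℝ))⁻¹) : ℝ) : ℂ) * ker (2 ^ i.2 * τ₂) ((s : ℝ) / h₁)) *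
                    levelLargePart R Q (fun q ↦ (e ((k : ℝ) * q / P) * (2 * (qhat q : ℂ) * (2 * π / q)) *
                        (((Real.log (qhat q ^ Δ'))⁻¹ ^ (w.1 + w.2) : ℝ) : ℂ)) *
                      (((cutoffW ((4 * π ^ 2 * ((d₁ : ℝ) * (2 ^ i.1 * τ₁) * ((d₂ : ℝ) * (2 ^ i.2 * τ₂)))) *
                          ((q : ℝ))⁻¹) : ℝ) : ℂ) *
                        ((besselJ 1 ((4 * π * Real.sqrt (((l / d₁ : ℕ) : ℝ) * (2 ^ i.1 * τ₁) *
                            (((m / d₂ : ℕ) : ℝ) * (2 ^ i.2 * τ₂))) / ((r + 1 : ℕ) : ℝ)) * ((q : ℝ))⁻¹) : ℝ) : ℂ) *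
                          Complex.exp (((-2 * π * ((2 ^ i.1 * τ₁) * ((h₁ : ℝ) / (r + 1)) +
                              (2 ^ i.2 * τ₂) * ((((l / d₁ : ℕ) : ℤ) * (m / d₂ : ℕ) : ℝ) / ((h₁ : ℝ) * (r + 1)))) *
                            ((q : ℝ))⁻¹ : ℝ) : ℂ) * I))) n a) := by
  have hQ0 : ∀ q ∈ Q, q ≠ 0 := fun q hq ↦ (hQp q hq).1.ne_zero
  rw [levelLargePart_window_block_eq_separated R Q hQ hQb hΔ hε₀ D T hl hm d₁ d₂ i s hQp a]
  refine congrArg₂ (· * ·) rfl ?_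
  refine Finset.sum_congr rfl fun k _ ↦ ?_
  refine congrArg₂ (· * ·) rfl ?_
  refine Finset.sum_congr rfl fun w _ ↦ ?_
  refine congrArg₂ (· * ·) rfl ?_
  have h4 := levelLargePart_boxTransform_eq_unitBox R Q hQ0 hl hm hd₁ hd₂ r i h₁ s
    (fun q ↦ e ((k : ℝ) * q / P) * (2 * (qhat q : ℂ) * (2 * π / q)) *
      (((Real.log (qhat q ^ Δ'))⁻¹ ^ (w.1 + w.2) : ℝ) : ℂ)) a
  beta_reduce at h4
  rw [← h4]

end Summit.Parity.GeneralizedHardyLittlewood.Theorems.BeyondDiagonalBeatsQuarter.OffDiag
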